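import Summits.BirchSwinnertonDyer.BirchSwinnertonDyer.Theses.TorsionLayerDescent
import Summits.BirchSwinnertonDyer.BirchSwinnertonDyer.Theorems.TorsionLayerDescentRungCoprime
import Summits.BirchSwinnertonDyer.BirchSwinnertonDyer.Theorems.Rank1ResidualX9CMPartner
import Summits.BirchSwinnertonDyer.Rank1Residual.X9.LeafDischargeScalarImage
import Literature.NumberTheory.EllipticCurves.CastellaGrossiLeeSkinner2022.StabilizedHeegnerDataOfTowerProofs
import Literature.NumberTheory.EllipticCurves.LambdaAdicSelmerDataProofs
import Literature.NumberTheory.EllipticCurves.IwasawaSelmerDualProofs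
import Literature.NumberTheory.EllipticCurves.BSDSelmerCMPConverseRankOneProofs
import Literature.NumberTheory.EllipticCurves.BSDSelmerCMPConverseHeegnerFieldProofs
import Literature.NumberTheory.EllipticCurves.Rank1Residual.ClassX1KellerYinTypeA
import HarnessLib

/-!
# Route `TorsionLayerDescent` — LEVER-REGIME rungs of the deciding crux BY ID: the localized Howard
containment at EVERY class number (`p ∣ h_K` included, torsion depth `δ ≥ 1` typed)

Route-free helper file (`--supports stmt-BirchSwinnertonDyer-25546`; no route item is closed; no import of
another route's cone). Tribunal T3 / BC5 evidence for `route-BirchSwinnertonDyer-TorsionLayerDescent` (K6 leaf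
`Rank1Residual.BSDpOnClassX9`, never summit credit), complementing the witness of record
`TorsionLayerDescentRung.rung_coprimeClassNumber` (`TorsionLayerDescentRungCoprime.lean`: the PRINTED regime
`p ∤ h_K` of the deciding crux; lever not exercised).

The deciding crux `Theses.TorsionLayerDescent.HowardContainmentAnyClassNumberOfPrint` (stmt-25546) is
`MastellaZermanHowardDivisibility → CGLSHowardDivisibilityLocalized → AnticyclotomicTowerInRingClassFields →
HowardContainmentAnyClassNumber`; crux A (stmt-23161) asks, on EVERY X9 Heegner frame with NO hypothesis on
`h_K`, for `jbar, D`, a Heegner family `ℋ_F` and a Selmer dual `X` with `I(ℋ_F)² ⊆ char_Λ(X_{Λ-tors})`. The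
route's LEVER is the torsion layer of the ring-class tower: at `p ∣ h_K` the anticyclotomic layers may start
INSIDE the Hilbert class field (`K_1 ⊆ K[1]`, torsion depth `δ ≥ 1`), where Howard 2004 Thm. B and
Mastella–Zerman 2026 Cor. 4.6 (both printed under `p ∤ h_K`) are silent, and Castella–Grossi–Lee–Skinner 2022
§4.1 replace Howard's norm-point family by the `d(k)`-shifted stabilised classes `Λκ_∞` (Rem. 4.1.4) and prove
the divisibility LOCALIZED (Thm. 4.1.3: in `Λ[1/p,1/(γ-1)]`; in `Λ[1/p]` at Selmer corank one), ANY `h_K`.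

THIS FILE proves, from the route's OWN print binders BY ID — `hCGLS : Theses.TorsionLayerDescent.
CGLSHowardDivisibilityLocalized` (stmt-25234 = the body of the fact `CastellaGrossiLeeSkinner2022.
thm413_rankOne_charIdeal_torsion_dvd_localized` at universe 0) and `hTw : Theses.TorsionLayerDescent.
AnticyclotomicTowerInRingClassFields` (stmt-25236), two of the three binders of the deciding crux — on crux
A's frame IN ITS LETTER (`Rank1Residual.ClassX9 W p`, `d_K ≠ -3, -4`, Heegner for `N_E` and `p`,
anticyclotomic `(κ, γ)`, data `Dt, H, ιC`) on the slice `d_K` odd (CGLS's (disc); A also allows even `d_K`):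
* §0 `thm413Hypotheses_of_frame` — CGLS's standing hypotheses on such a frame (no class-number input);
* §1 `stabilizedContainmentAt_tied` — at a GIVEN `jbar`: `(D, C, X)` with the stabilised Heegner datum `C`
  TIED (`C.Dt = Dt`), its torsion depth typed (`0 < C.depth ↔ K_1 ⊆ K[1]`), `(p^m)(T^n)·I(Λκ_∞(C))² ⊆
  char_Λ(X_tors)`, and `(p^m)·I(Λκ_∞(C))² ⊆ char_Λ(X_tors)` at Selmer corank one — EVERY class number;
* §2 the rungs in A's `∀ frame, ∃ jbar …` letter: `rung_pTLocalized_anyClassNumber` (frame + `d_K` odd only),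
  `rung_localized_anyClassNumber` (+ `rank E(K) = 1`, `Ш(E/K)[p^∞]` finite), and the LEVER REGIME explicit:
  `rung_localized_divisibleClassNumber` (`p ∣ h_K`, the complement of the printed regime) and
  `rung_depthPos_localized` / `rung_depthPos_pTLocalized` (`δ ≥ 1`: `ringClassSubgroup K 1 jbar ≤
  κ.layerSubgroup 1`, with the produced datum's depth CERTIFIED positive, `0 < C.depth`);
* §3 `rung_twoRegimes_localized` — both regimes side by side from the THREE binders of the deciding crux.

HONEST LABEL. PRINT modulo typing (CGLS Thm. 4.1.3 + Cor. 3.4.2 + Rem. 4.1.4 through `hCGLS`; `K_k ⊂ K[p^d]`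
through `hTw`; `C` by the tree's PROVED norm-point existence, `StabilizedHeegnerData.exists_of_tower`). LEVER
REGIME: yes — no class-number hypothesis anywhere, `p ∣ h_K` and `δ ≥ 1` typed; outside the regime of every
Howard-type fact of the tree (`HowardHypotheses.not_dvd_classNumber`, `MastellaZerman2026.Hypotheses.
not_dvd_classNumber`) and outside the known regime of `BSDpOnClassX9` (BCS 2025 Thm. 1.1.2 (b) needs (sur)/(im),
violated on X9). WHAT IT IS NOT: the conclusion is LOCALIZED at `p` (the `μ`-part is inverted) and is stated
for CGLS's STABILISED module `Λκ_∞(C)`, not Howard's `ℋ_F` — the integral promotion (`μ`-part) and the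
envelope `ℋ_F ⊆ Λκ_∞(C)` up to `p^e` are the route's open residual at `p ∣ h_K`, BEYOND PRINT, untouched.
«beyond-print theorem»: no. Neither BSD nor `BSD_p` on class X9 nor crux A is proved here. Credit: §0–§1
follow seat x9-p2's `X9.thm413Hypotheses_of_lightFrame` / `X9.stabilizedLocalizedContainmentAt_of_thm413_
of_tower` (p607064, route PrintX9's letter), here on route TorsionLayerDescent's binders and route-free imports.

References: [CastellaGrossiLeeSkinner2022] Invent. Math. 227 (2022) Thm. 4.1.3, Cor. 3.4.2, Thm. 4.1.1 +
Rem. 4.1.4 (arXiv:2008.02571 p. 22: `d(k)`); [Howard2004HeegnerKolyvagin] Compositio 140 (2004) Thm. B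
(`p ∤ h_K`); [MastellaZerman2026] arXiv:2505.08710 Cor. 4.6 (`p ∤ h_K`); [PerrinRiou1987BSMF] §1
(`K_∞ ⊂ K[p^∞]`); [GreenbergLNM1716] §1 (Selmer corank); [GrossLMS1991] §2 (`E(K)[p] = 0`).
-/

set_option autoImplicit false
set_option linter.dupNamespace false

noncomputable section

open scoped Classical

open WeierstrassCurve NumberField Literature.NumberTheory.EllipticCurves
  Literature.NumberTheory.EllipticCurves.ModularForms
  Literature.NumberTheory.EllipticCurves.CastellaGrossiLeeSkinner2022

namespace Summit.BirchSwinnertonDyer.BirchSwinnertonDyer.Theorems.TorsionLayerDescentRung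

section Given

variable {W : WeierstrassCurve ℚ} [W.IsElliptic] [W.IsGloballyMinimal] {p : ℕ} [Fact p.Prime]
  [NeZero (W.conductorNorm ℤ)] {K : Type} [Field K] [NumberField K]

/-! ### §0 CGLS's standing hypotheses on a frame of crux A's letter with `d_K` odd -/

omit [NeZero (W.conductorNorm ℤ)] in
/-- **`Thm413Hypotheses` on an X9 frame (crux A's letter, `d_K` odd)**: `p ≠ 2`, ordinary and `p ∤ d_K`
(`p` split, odd) from `ClassX9`; (h1) `E(K)[p] = 0` from (irr) over the quadratic `K`
(`torsionBy_eq_bot_of_isImaginaryQuadratic_of_hasIrreducibleModPGaloisRep`); the rest are binders. NO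
class-number input. [cite: CastellaGrossiLeeSkinner2022, §3.2 standing + (h1), §4.1 (Heeg), (disc)]
[cite: GrossLMS1991, §2] -/
theorem thm413Hypotheses_of_frame
    (hX9 : Summit.BirchSwinnertonDyer.BirchSwinnertonDyer.Rank1Residual.ClassX9 W p)
    (hK : IsImaginaryQuadratic K) (hodd : Odd (NumberField.discr K)) (h3 : NumberField.discr K ≠ -3)
    (hHN : SatisfiesHeegnerHypothesis (W.conductorNorm ℤ) K) (hHp : SatisfiesHeegnerHypothesis p K)
    {κ : ZpExtension K p} (hκ : κ.IsAnticyclotomic) {γ : Field.absoluteGaloisGroup K}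
    (hγ : κ.IsTopGenerator γ) :
    Thm413Hypotheses (W.conductorNorm ℤ) W K p κ γ := by
  have hX9' :=
    Summit.BirchSwinnertonDyer.BirchSwinnertonDyer.Rank1Residual.classX9_census_of_classX9 W p hX9
  exact
    { isElliptic := inferInstance
      level := rfl
      p_ne_two := hX9'.ne_two
      ordinary := hX9'.isOrdinaryAt
      isImaginaryQuadratic := hK
      not_dvd_discr := Rank1Residual.not_dvd_discr_of_split hK Fact.out hX9'.ne_two hHp
      noPTorsion := fun Q hQ ↦ by
        have hbot := torsionBy_eq_bot_of_isImaginaryQuadratic_of_hasIrreducibleModPGaloisRep W K hK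
          (Fact.out : p.Prime) hX9'.irr
        have hmem : Q ∈ AddSubgroup.torsionBy (W.baseChange K).toAffine.Point (p : ℤ) :=
          AddSubgroup.torsionBy.nsmul_iff.mpr hQ
        rw [hbot, AddSubgroup.mem_bot] at hmem
        exact hmem
      heegner := hHN
      discr_odd := hodd
      discr_ne := h3
      anticyclotomic := hκ
      topGenerator := hγ }

/-! ### §1 The tied, depth-typed stabilised containment at a GIVEN `jbar` (every class number) -/

/-- **CGLS 2022 Thm. 4.1.3 on an X9 frame of crux A's letter with `d_K` odd, at a GIVEN `jbar`, from
the route binders `hCGLS`, `hTw` BY ID**: `Λ`-adic Selmer data `D`, a stabilised Heegner datum `C` TIED to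
the frame (`C.Dt = Dt`) with its torsion depth typed (`0 < C.depth ↔ K_1 ⊆ K[1]`), a Selmer dual `X`,
with (i)+(ii) `(p^m)(T^n)·I(Λκ_∞(C))² ⊆ char_Λ(X_{Λ-tors})` for some `m n`, and ("Moreover" = Cor. 3.4.2)
`(p^m)·I(Λκ_∞(C))² ⊆ char_Λ(X_{Λ-tors})` for some `m` when `corank_{ℤ_p} Sel_{p^∞}(E/K) = 1` — NO
class-number hypothesis. Data: `D` (`nonempty_lambdaAdicSelmerData`), `X` (`nonempty_selmerDualData_holds`),
`C` (`StabilizedHeegnerData.exists_of_tower` on `(Dt, H.β)` fed `hTw`). PRINT modulo typing;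
«beyond-print theorem»: no. [cite: CastellaGrossiLeeSkinner2022, Thm. 4.1.3 (i)–(ii) + "Moreover", Cor. 3.4.2, Thm. 4.1.1 + Rem. 4.1.4 (arXiv:2008.02571 p. 22)]
[cite: PerrinRiou1987BSMF, §1] -/
theorem stabilizedContainmentAt_tied
    (hCGLS : Theses.TorsionLayerDescent.CGLSHowardDivisibilityLocalized)
    (hTw : Theses.TorsionLayerDescent.AnticyclotomicTowerInRingClassFields)
    (hX9 : Summit.BirchSwinnertonDyer.BirchSwinnertonDyer.Rank1Residual.ClassX9 W p)
    (hK : IsImaginaryQuadratic K) (hodd : Odd (NumberField.discr K)) (h3 : NumberField.discr K ≠ -3)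
    (hHN : SatisfiesHeegnerHypothesis (W.conductorNorm ℤ) K) (hHp : SatisfiesHeegnerHypothesis p K)
    (κ : ZpExtension K p) (hκ : κ.IsAnticyclotomic)
    (γ : Field.absoluteGaloisGroup K) (hγ : κ.IsTopGenerator γ)
    (Dt : ModularParametrizationData W (W.conductorNorm ℤ))
    (H : HeegnerDatum (W.conductorNorm ℤ) (NumberField.discr K)) (jbar : AlgebraicClosure K →+* ℂ) :
    ∃ (D : (W.baseChange K).LambdaAdicSelmerData κ γ)
      (C : StabilizedHeegnerData (W.conductorNorm ℤ) W K κ jbar) (X : (W.baseChange K).SelmerDualData κ γ),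
      C.Dt = Dt ∧ (0 < C.depth ↔ ringClassSubgroup K 1 jbar ≤ κ.layerSubgroup 1) ∧
      (∃ m n : ℕ, Ideal.span {((p : IwasawaAlgebra p) ^ m)} *
          Ideal.span {((PowerSeries.X : IwasawaAlgebra p) ^ n)} * stabilizedHeegnerCharIdeal D C ^ 2 ≤
        Module.charIdeal (IwasawaAlgebra p) (Submodule.torsion (IwasawaAlgebra p) X.X)) ∧
      ((W.baseChange K).selmerCorank p = 1 →
        ∃ m : ℕ, Ideal.span {((p : IwasawaAlgebra p) ^ m)} * stabilizedHeegnerCharIdeal D C ^ 2 ≤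
          Module.charIdeal (IwasawaAlgebra p) (Submodule.torsion (IwasawaAlgebra p) X.X)) := by
  have hX9' :=
    Summit.BirchSwinnertonDyer.BirchSwinnertonDyer.Rank1Residual.classX9_census_of_classX9 W p hX9
  have hp_odd : Odd p := (Fact.out : p.Prime).odd_of_ne_two hX9'.ne_two
  obtain ⟨D⟩ := LambdaAdicSelmerDataExists.nonempty_lambdaAdicSelmerData (W.baseChange K) p κ hγ
  obtain ⟨X⟩ := (W.baseChange K).nonempty_selmerDualData_holds κ γ hγ
  -- the `d(k)`-shifted stabilised datum on `(Dt, H.β)`, tied, depth typed (tower fact `hTw`)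
  obtain ⟨C, hCDt, -, hdepth⟩ := StabilizedHeegnerData.exists_of_tower (W := W) (κ := κ) (jbar := jbar)
    hK hHN hX9'.not_dvd_conductorNorm Dt H.dvd_sq_sub (fun k ↦ hTw K p hp_odd hK κ hκ jbar k)
  -- CGLS Thm. 4.1.3 at the frame (the binder IS the fact at universe 0)
  have h413 : thm413_rankOne_charIdeal_torsion_dvd_localized.{0} := hCGLS
  have hyp := thm413Hypotheses_of_frame hX9 hK hodd h3 hHN hHp hκ hγ
  refine ⟨D, C, X, hCDt, hdepth, ?_, fun hrk ↦ ?_⟩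
  · obtain ⟨m, n, hmn⟩ := charIdeal_torsion_dvd_localized_of_thm413 h413 hyp D C X
    exact ⟨m, n, Ideal.le_of_dvd hmn⟩
  · exact span_pow_mul_sq_le_charIdeal_torsion_of_thm413 h413 hyp hrk D C X

end Given

/-! ### §2 The rungs in crux A's letter (`∀ frame …, ∃ jbar …`), lever regime explicit -/

/-- **Rung (every class number, `Λ[1/p, 1/T]`)**: on EVERY frame of crux A with `d_K` odd — NO hypothesis
on `h_K`, on the rank or on `Ш` — `jbar, D`, a stabilised Heegner datum `C` tied to `Dt`, `X`, `m n` with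
`(p^m)(T^n)·I(Λκ_∞(C))² ⊆ char_Λ(X_{Λ-tors})`; from `hCGLS`, `hTw` BY ID (`jbar := IsAlgClosed.lift`
along `ιC`). PRINT modulo typing; «beyond-print theorem»: no.
[cite: CastellaGrossiLeeSkinner2022, Thm. 4.1.3 (i)–(ii) + Rem. 4.1.4] -/
theorem rung_pTLocalized_anyClassNumber
    (hCGLS : Theses.TorsionLayerDescent.CGLSHowardDivisibilityLocalized)
    (hTw : Theses.TorsionLayerDescent.AnticyclotomicTowerInRingClassFields) :
    ∀ (W : WeierstrassCurve ℚ) [W.IsElliptic] [W.IsGloballyMinimal] (p : ℕ) [Fact p.Prime]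
      [NeZero (W.conductorNorm ℤ)] (K : Type) [Field K] [NumberField K],
      Summit.BirchSwinnertonDyer.BirchSwinnertonDyer.Rank1Residual.ClassX9 W p →
      IsImaginaryQuadratic K → NumberField.discr K ≠ -3 → NumberField.discr K ≠ -4 →
      SatisfiesHeegnerHypothesis (W.conductorNorm ℤ) K → SatisfiesHeegnerHypothesis p K →
      ∀ (κ : ZpExtension K p), κ.IsAnticyclotomic → ∀ (γ : Field.absoluteGaloisGroup K),
      κ.IsTopGenerator γ →
      ∀ (Dt : ModularForms.ModularParametrizationData W (W.conductorNorm ℤ))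
        (H : HeegnerDatum (W.conductorNorm ℤ) (NumberField.discr K)) (ιC : K →+* ℂ),
      Odd (NumberField.discr K) →
      ∃ (jbar : AlgebraicClosure K →+* ℂ) (D : (W.baseChange K).LambdaAdicSelmerData κ γ)
        (C : StabilizedHeegnerData (W.conductorNorm ℤ) W K κ jbar)
        (X : (W.baseChange K).SelmerDualData κ γ) (m n : ℕ),
        C.Dt = Dt ∧
        Ideal.span {((p : IwasawaAlgebra p) ^ m)} * Ideal.span {((PowerSeries.X : IwasawaAlgebra p) ^ n)} *
            stabilizedHeegnerCharIdeal D C ^ 2 ≤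
          Module.charIdeal (IwasawaAlgebra p) (Submodule.torsion (IwasawaAlgebra p) X.X) := by
  intro W _ _ p _ _ K _ _ hX9 hK h3 _ hHN hHp κ hκ γ hγ Dt H ιC hodd
  -- a complex embedding of `K̄` extending `ιC` (`ℂ` is algebraically closed)
  letI : Algebra K ℂ := ιC.toAlgebra
  let jbar : AlgebraicClosure K →+* ℂ :=
    (IsAlgClosed.lift (R := K) (M := ℂ) (S := AlgebraicClosure K)).toRingHom
  obtain ⟨D, C, X, hCDt, -, ⟨m, n, h⟩, -⟩ :=
    stabilizedContainmentAt_tied hCGLS hTw hX9 hK hodd h3 hHN hHp κ hκ γ hγ Dt H jbar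
  exact ⟨jbar, D, C, X, m, n, hCDt, h⟩

/-- **Rung (every class number, `Λ[1/p]`, Selmer corank one)**: on EVERY frame of crux A with `d_K` odd,
`rank E(K) = 1` and `Ш(E/K)[p^∞]` finite — NO hypothesis on `h_K` — `jbar, D, C` (tied), `X`, `m` with
`(p^m)·I(Λκ_∞(C))² ⊆ char_Λ(X_{Λ-tors})`; from `hCGLS`, `hTw` BY ID. The route's thesis regime "for every
class number", LOCALIZED at `p`. PRINT modulo typing; «beyond-print theorem»: no.
[cite: CastellaGrossiLeeSkinner2022, Thm. 4.1.3 ("Moreover"), Cor. 3.4.2, Rem. 4.1.4] [cite: GreenbergLNM1716, §1] -/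
theorem rung_localized_anyClassNumber
    (hCGLS : Theses.TorsionLayerDescent.CGLSHowardDivisibilityLocalized)
    (hTw : Theses.TorsionLayerDescent.AnticyclotomicTowerInRingClassFields) :
    ∀ (W : WeierstrassCurve ℚ) [W.IsElliptic] [W.IsGloballyMinimal] (p : ℕ) [Fact p.Prime]
      [NeZero (W.conductorNorm ℤ)] (K : Type) [Field K] [NumberField K],
      Summit.BirchSwinnertonDyer.BirchSwinnertonDyer.Rank1Residual.ClassX9 W p →
      IsImaginaryQuadratic K → NumberField.discr K ≠ -3 → NumberField.discr K ≠ -4 →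
      SatisfiesHeegnerHypothesis (W.conductorNorm ℤ) K → SatisfiesHeegnerHypothesis p K →
      ∀ (κ : ZpExtension K p), κ.IsAnticyclotomic → ∀ (γ : Field.absoluteGaloisGroup K),
      κ.IsTopGenerator γ →
      ∀ (Dt : ModularForms.ModularParametrizationData W (W.conductorNorm ℤ))
        (H : HeegnerDatum (W.conductorNorm ℤ) (NumberField.discr K)) (ιC : K →+* ℂ),
      Odd (NumberField.discr K) → (W.baseChange K).mordellWeilRank = 1 →
      Finite (AddCommGroup.primaryComponent (W.baseChange K).sha p) →
      ∃ (jbar : AlgebraicClosure K →+* ℂ) (D : (W.baseChange K).LambdaAdicSelmerData κ γ)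
        (C : StabilizedHeegnerData (W.conductorNorm ℤ) W K κ jbar)
        (X : (W.baseChange K).SelmerDualData κ γ) (m : ℕ),
        C.Dt = Dt ∧
        Ideal.span {((p : IwasawaAlgebra p) ^ m)} * stabilizedHeegnerCharIdeal D C ^ 2 ≤
          Module.charIdeal (IwasawaAlgebra p) (Submodule.torsion (IwasawaAlgebra p) X.X) := by
  intro W _ _ p _ _ K _ _ hX9 hK h3 _ hHN hHp κ hκ γ hγ Dt H ιC hodd hrk hfin
  letI : Algebra K ℂ := ιC.toAlgebra
  let jbar : AlgebraicClosure K →+* ℂ :=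
    (IsAlgClosed.lift (R := K) (M := ℂ) (S := AlgebraicClosure K)).toRingHom
  obtain ⟨D, C, X, hCDt, -, -, hmore⟩ :=
    stabilizedContainmentAt_tied hCGLS hTw hX9 hK hodd h3 hHN hHp κ hκ γ hγ Dt H jbar
  obtain ⟨m, h⟩ :=
    hmore (selmerCorank_eq_one_of_mordellWeilRank_eq_one_of_finite (W.baseChange K) p hrk hfin)
  exact ⟨jbar, D, C, X, m, hCDt, h⟩

/-- **LEVER REGIME `p ∣ h_K`, rung (`Λ[1/p]`, Selmer corank one)** — the COMPLEMENT of the printed regime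
of the witness of record `rung_coprimeClassNumber` (`p ∤ h_K`: Mastella–Zerman Cor. 4.6, Howard Thm. B): on
every frame of crux A with `d_K` odd, `rank E(K) = 1`, `Ш(E/K)[p^∞]` finite AND `p ∣ h_K`, the tied
stabilised datum with `(p^m)·I(Λκ_∞(C))² ⊆ char_Λ(X_{Λ-tors})`; from `hCGLS`, `hTw` BY ID. Every
Howard-type fact of the tree (`HowardHypotheses.not_dvd_classNumber`,
`MastellaZerman2026.Hypotheses.not_dvd_classNumber`) is silent here; what remains of crux A on this regime
(integral promotion, envelope `ℋ_F ⊆ Λκ_∞(C)`) is beyond print and untouched. PRINT modulo typing;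
«beyond-print theorem»: no. [cite: CastellaGrossiLeeSkinner2022, Thm. 4.1.3 ("Moreover"), Rem. 4.1.4, §4.1 (any h_K)]
[cite: Howard2004HeegnerKolyvagin, Thm. B (printed under p ∤ h_K — for contrast)] -/
theorem rung_localized_divisibleClassNumber
    (hCGLS : Theses.TorsionLayerDescent.CGLSHowardDivisibilityLocalized)
    (hTw : Theses.TorsionLayerDescent.AnticyclotomicTowerInRingClassFields) :
    ∀ (W : WeierstrassCurve ℚ) [W.IsElliptic] [W.IsGloballyMinimal] (p : ℕ) [Fact p.Prime]
      [NeZero (W.conductorNorm ℤ)] (K : Type) [Field K] [NumberField K],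
      Summit.BirchSwinnertonDyer.BirchSwinnertonDyer.Rank1Residual.ClassX9 W p →
      IsImaginaryQuadratic K → NumberField.discr K ≠ -3 → NumberField.discr K ≠ -4 →
      SatisfiesHeegnerHypothesis (W.conductorNorm ℤ) K → SatisfiesHeegnerHypothesis p K →
      ∀ (κ : ZpExtension K p), κ.IsAnticyclotomic → ∀ (γ : Field.absoluteGaloisGroup K),
      κ.IsTopGenerator γ →
      ∀ (Dt : ModularForms.ModularParametrizationData W (W.conductorNorm ℤ))
        (H : HeegnerDatum (W.conductorNorm ℤ) (NumberField.discr K)) (ιC : K →+* ℂ),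
      p ∣ NumberField.classNumber K →
      Odd (NumberField.discr K) → (W.baseChange K).mordellWeilRank = 1 →
      Finite (AddCommGroup.primaryComponent (W.baseChange K).sha p) →
      ∃ (jbar : AlgebraicClosure K →+* ℂ) (D : (W.baseChange K).LambdaAdicSelmerData κ γ)
        (C : StabilizedHeegnerData (W.conductorNorm ℤ) W K κ jbar)
        (X : (W.baseChange K).SelmerDualData κ γ) (m : ℕ),
        C.Dt = Dt ∧
        Ideal.span {((p : IwasawaAlgebra p) ^ m)} * stabilizedHeegnerCharIdeal D C ^ 2 ≤
          Module.charIdeal (IwasawaAlgebra p) (Submodule.torsion (IwasawaAlgebra p) X.X) := by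
  intro W _ _ p _ _ K _ _ hX9 hK h3 h4 hHN hHp κ hκ γ hγ Dt H ιC _ hodd hrk hfin
  exact rung_localized_anyClassNumber hCGLS hTw W p K hX9 hK h3 h4 hHN hHp κ hκ γ hγ Dt H ιC hodd hrk hfin

/-- **LEVER REGIME, torsion depth `δ ≥ 1` typed, rung (`Λ[1/p]`, Selmer corank one)**: on every frame of
crux A with `d_K` odd, `rank E(K) = 1`, `Ш(E/K)[p^∞]` finite, at a GIVEN `jbar` (the shape of the line
stubs) whose FIRST anticyclotomic layer lies in the Hilbert class field `K[1]`
(`ringClassSubgroup K 1 jbar ≤ κ.layerSubgroup 1`, i.e. `K_∞ ∩ K[1] ≠ K` — the torsion layer the route is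
named after; it forces `p ∣ h_K`, as `[K_1 : K] = p` divides `[K[1] : K] = h_K`): `D`, a stabilised Heegner
datum `C` tied to `Dt` whose torsion depth is CERTIFIED POSITIVE (`0 < C.depth`), `X`, `m` with
`(p^m)·I(Λκ_∞(C))² ⊆ char_Λ(X_{Λ-tors})`; from `hCGLS`, `hTw` BY ID. The integral containment at `δ ≥ 1`
is the route's open residual (beyond print). PRINT modulo typing; «beyond-print theorem»: no.
[cite: CastellaGrossiLeeSkinner2022, Thm. 4.1.1 proof (d(k) = 0 for k ≤ δ, arXiv:2008.02571 p. 22), Thm. 4.1.3, Rem. 4.1.4]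
[cite: PerrinRiou1987BSMF, §1] -/
theorem rung_depthPos_localized
    (hCGLS : Theses.TorsionLayerDescent.CGLSHowardDivisibilityLocalized)
    (hTw : Theses.TorsionLayerDescent.AnticyclotomicTowerInRingClassFields) :
    ∀ (W : WeierstrassCurve ℚ) [W.IsElliptic] [W.IsGloballyMinimal] (p : ℕ) [Fact p.Prime]
      [NeZero (W.conductorNorm ℤ)] (K : Type) [Field K] [NumberField K],
      Summit.BirchSwinnertonDyer.BirchSwinnertonDyer.Rank1Residual.ClassX9 W p →
      IsImaginaryQuadratic K → NumberField.discr K ≠ -3 → NumberField.discr K ≠ -4 →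
      SatisfiesHeegnerHypothesis (W.conductorNorm ℤ) K → SatisfiesHeegnerHypothesis p K →
      ∀ (κ : ZpExtension K p), κ.IsAnticyclotomic → ∀ (γ : Field.absoluteGaloisGroup K),
      κ.IsTopGenerator γ →
      ∀ (Dt : ModularForms.ModularParametrizationData W (W.conductorNorm ℤ))
        (H : HeegnerDatum (W.conductorNorm ℤ) (NumberField.discr K)) (ιC : K →+* ℂ)
        (jbar : AlgebraicClosure K →+* ℂ),
      ringClassSubgroup K 1 jbar ≤ κ.layerSubgroup 1 →
      Odd (NumberField.discr K) → (W.baseChange K).mordellWeilRank = 1 →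
      Finite (AddCommGroup.primaryComponent (W.baseChange K).sha p) →
      ∃ (D : (W.baseChange K).LambdaAdicSelmerData κ γ)
        (C : StabilizedHeegnerData (W.conductorNorm ℤ) W K κ jbar)
        (X : (W.baseChange K).SelmerDualData κ γ) (m : ℕ),
        C.Dt = Dt ∧ 0 < C.depth ∧
        Ideal.span {((p : IwasawaAlgebra p) ^ m)} * stabilizedHeegnerCharIdeal D C ^ 2 ≤
          Module.charIdeal (IwasawaAlgebra p) (Submodule.torsion (IwasawaAlgebra p) X.X) := by
  intro W _ _ p _ _ K _ _ hX9 hK h3 _ hHN hHp κ hκ γ hγ Dt H _ jbar hδ hodd hrk hfin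
  obtain ⟨D, C, X, hCDt, hdepth, -, hmore⟩ :=
    stabilizedContainmentAt_tied hCGLS hTw hX9 hK hodd h3 hHN hHp κ hκ γ hγ Dt H jbar
  obtain ⟨m, h⟩ :=
    hmore (selmerCorank_eq_one_of_mordellWeilRank_eq_one_of_finite (W.baseChange K) p hrk hfin)
  exact ⟨D, C, X, m, hCDt, hdepth.mpr hδ, h⟩

/-- **LEVER REGIME, torsion depth `δ ≥ 1` typed, rung (`Λ[1/p, 1/T]`, NO rank / `Ш` hypothesis)** — the
letter of the registered line stub `TorsionDepth.Stmt.stub_depthPos_localized` (skeleton `torsion_depth` on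
stmt-23161) with exactly three differences, each stated: (a) the slice `d_K` odd (CGLS (disc)); (b) CGLS's
stabilised module `Λκ_∞(C)` (tied, depth certified positive) in place of Howard's `ℋ_F` — the envelope
`ℋ_F ⊆ Λκ_∞(C)` up to `p^e` is the open stub s_env; (c) the print binders `hCGLS`, `hTw` as hypotheses (the
stub is stated bare). Conclusion in the stub's spelling `span {p^m * T^n} * I² ≤ char`. PRINT modulo
typing; «beyond-print theorem»: no. [cite: CastellaGrossiLeeSkinner2022, Thm. 4.1.3 (i)–(ii), Thm. 4.1.1 + Rem. 4.1.4] -/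
theorem rung_depthPos_pTLocalized
    (hCGLS : Theses.TorsionLayerDescent.CGLSHowardDivisibilityLocalized)
    (hTw : Theses.TorsionLayerDescent.AnticyclotomicTowerInRingClassFields) :
    ∀ (W : WeierstrassCurve ℚ) [W.IsElliptic] [W.IsGloballyMinimal] (p : ℕ) [Fact p.Prime]
      [NeZero (W.conductorNorm ℤ)] (K : Type) [Field K] [NumberField K],
      Summit.BirchSwinnertonDyer.BirchSwinnertonDyer.Rank1Residual.ClassX9 W p →
      IsImaginaryQuadratic K → NumberField.discr K ≠ -3 → NumberField.discr K ≠ -4 →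
      SatisfiesHeegnerHypothesis (W.conductorNorm ℤ) K → SatisfiesHeegnerHypothesis p K →
      ∀ (κ : ZpExtension K p), κ.IsAnticyclotomic → ∀ (γ : Field.absoluteGaloisGroup K),
      κ.IsTopGenerator γ →
      ∀ (Dt : ModularForms.ModularParametrizationData W (W.conductorNorm ℤ))
        (H : HeegnerDatum (W.conductorNorm ℤ) (NumberField.discr K)) (ιC : K →+* ℂ)
        (jbar : AlgebraicClosure K →+* ℂ),
      ringClassSubgroup K 1 jbar ≤ κ.layerSubgroup 1 →
      Odd (NumberField.discr K) →
      ∃ (D : (W.baseChange K).LambdaAdicSelmerData κ γ)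
        (C : StabilizedHeegnerData (W.conductorNorm ℤ) W K κ jbar)
        (X : (W.baseChange K).SelmerDualData κ γ) (m n : ℕ),
        C.Dt = Dt ∧ 0 < C.depth ∧
        Ideal.span {((p : IwasawaAlgebra p) ^ m * (PowerSeries.X : IwasawaAlgebra p) ^ n)} *
            stabilizedHeegnerCharIdeal D C ^ 2 ≤
          Module.charIdeal (IwasawaAlgebra p) (Submodule.torsion (IwasawaAlgebra p) X.X) := by
  intro W _ _ p _ _ K _ _ hX9 hK h3 _ hHN hHp κ hκ γ hγ Dt H _ jbar hδ hodd
  obtain ⟨D, C, X, hCDt, hdepth, ⟨m, n, h⟩, -⟩ :=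
    stabilizedContainmentAt_tied hCGLS hTw hX9 hK hodd h3 hHN hHp κ hκ γ hγ Dt H jbar
  refine ⟨D, C, X, m, n, hCDt, hdepth.mpr hδ, ?_⟩
  rwa [Ideal.span_singleton_mul_span_singleton] at h

/-! ### §3 The two regimes of the deciding crux side by side, from its three print binders -/

/-- **Both regimes from the THREE print binders of the deciding crux `HowardContainmentAnyClassNumberOfPrint`
(stmt-25546)**, on every frame of crux A with `d_K` odd, `rank E(K) = 1`, `Ш(E/K)[p^∞]` finite: (PRINTED
REGIME, witness of record) IF `p ∤ h_K`, Howard's INTEGRAL containment `I(ℋ_F)² ⊆ char_Λ(X_tors)` for a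
Heegner family (from `hMZ`, via `rung_coprimeClassNumber`); AND (EVERY CLASS NUMBER, lever side) the LOCALIZED
stabilised containment `(p^m)·I(Λκ_∞(C))² ⊆ char_Λ(X'_tors)`, `C.Dt = Dt` (from `hCGLS`, `hTw`). The gap
between the conjuncts at `p ∣ h_K` (integral promotion + envelope) is crux A's open content; nothing here
closes it. PRINT modulo typing; «beyond-print theorem»: no.
[cite: MastellaZerman2026, Cor. 4.6 (arXiv:2505.08710)] [cite: CastellaGrossiLeeSkinner2022, Thm. 4.1.3, Rem. 4.1.4] -/
theorem rung_twoRegimes_localized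
    (hMZ : Theses.TorsionLayerDescent.MastellaZermanHowardDivisibility)
    (hCGLS : Theses.TorsionLayerDescent.CGLSHowardDivisibilityLocalized)
    (hTw : Theses.TorsionLayerDescent.AnticyclotomicTowerInRingClassFields) :
    ∀ (W : WeierstrassCurve ℚ) [W.IsElliptic] [W.IsGloballyMinimal] (p : ℕ) [Fact p.Prime]
      [NeZero (W.conductorNorm ℤ)] (K : Type) [Field K] [NumberField K],
      Summit.BirchSwinnertonDyer.BirchSwinnertonDyer.Rank1Residual.ClassX9 W p →
      IsImaginaryQuadratic K → NumberField.discr K ≠ -3 → NumberField.discr K ≠ -4 →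
      SatisfiesHeegnerHypothesis (W.conductorNorm ℤ) K → SatisfiesHeegnerHypothesis p K →
      ∀ (κ : ZpExtension K p), κ.IsAnticyclotomic → ∀ (γ : Field.absoluteGaloisGroup K),
      κ.IsTopGenerator γ →
      ∀ (Dt : ModularForms.ModularParametrizationData W (W.conductorNorm ℤ))
        (H : HeegnerDatum (W.conductorNorm ℤ) (NumberField.discr K)) (ιC : K →+* ℂ),
      Odd (NumberField.discr K) → (W.baseChange K).mordellWeilRank = 1 →
      Finite (AddCommGroup.primaryComponent (W.baseChange K).sha p) →
      (¬ p ∣ NumberField.classNumber K →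
        ∃ (jbar : AlgebraicClosure K →+* ℂ) (D : (W.baseChange K).LambdaAdicSelmerData κ γ)
          (F : HeegnerFamily (W.conductorNorm ℤ) W K κ jbar) (X : (W.baseChange K).SelmerDualData κ γ),
          heegnerCharIdeal D F ^ 2 ≤
            Module.charIdeal (IwasawaAlgebra p) (Submodule.torsion (IwasawaAlgebra p) X.X)) ∧
      (∃ (jbar : AlgebraicClosure K →+* ℂ) (D : (W.baseChange K).LambdaAdicSelmerData κ γ)
        (C : StabilizedHeegnerData (W.conductorNorm ℤ) W K κ jbar)
        (X : (W.baseChange K).SelmerDualData κ γ) (m : ℕ),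
        C.Dt = Dt ∧
        Ideal.span {((p : IwasawaAlgebra p) ^ m)} * stabilizedHeegnerCharIdeal D C ^ 2 ≤
          Module.charIdeal (IwasawaAlgebra p) (Submodule.torsion (IwasawaAlgebra p) X.X)) := by
  intro W _ _ p _ _ K _ _ hX9 hK h3 h4 hHN hHp κ hκ γ hγ Dt H ιC hodd hrk hfin
  exact ⟨fun hhK ↦ rung_coprimeClassNumber hMZ W p K hX9 hK h3 h4 hHN hHp κ hκ γ hγ Dt H ιC hhK,
    rung_localized_anyClassNumber hCGLS hTw W p K hX9 hK h3 h4 hHN hHp κ hκ γ hγ Dt H ιC hodd hrk hfin⟩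

end Summit.BirchSwinnertonDyer.BirchSwinnertonDyer.Theorems.TorsionLayerDescentRung

end
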